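import Summits.ResolutionOfSingularities.ResolutionOfSingularities.Theorems.PAlterationPalterationThesisR1D
import Summits.ResolutionOfSingularities.ResolutionOfSingularities.Theorems.PAlterationPalterationThesisStubPerfectResOfAtoms
import Summits.ResolutionOfSingularities.ResolutionOfSingularities.Theorems.PAlterationPalterationThesisStubAtomsOfPerfectRes
import HarnessLib

/-!
# `PalterationThesis` (crux stmt-ResolutionOfSingularities-0552), line `Sketch` rev. c3: the crux
# as the three ATOMS (Temkin / RRLU1 / two-model patching) field by field

Helper file of the line lead (c3) for the skeleton `Cruxes/PalterationThesis/Lines/Sketch.lean`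
(`--supports stmt-ResolutionOfSingularities-0552`; it does not close the item). It assembles the
glue stubs of wave 1 — `stub_perfectRes_of_atoms` (p138022) and `stub_atoms_of_perfectRes`
(p138181) — into the certification that the rev. c3 reshape of the skeleton is an EQUIVALENCE.
Companion file: `PAlterationPalterationThesisPerfectAtomsResidues.lean` (the Picover-side residue
in its cover / quotient / `R1D` forms).

Over a field `K` of characteristic `p` write (all INLINED in the statements, no definitions):
* `Temkin_K` — Temkin 2013, Thm. 1.3.2 over the ground field `K` (every valuation ring `O ∋ K`
  of a finitely generated `F/K` becomes locally uniformizable over `K` on a finite purely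
  inseparable extension of `F`); the restriction to `K` of the named fact `Temkin2013`;
* `RRLU1_K` — local uniformization below height-one Frobenius sandwiches of regular affine
  `K`-varieties (`F ⊆ L = F(y)`, `y ^ p ∈ F`, `B ⊆ L` regular finitely generated with
  `Frac B = L`, `O ⊇ B`: uniformize `O ∩ F`), i.e. of the quotients of regular varieties by ONE
  `p`-closed rational vector field (item 0555, `PAlterationPialtSqueezeRRLU1.lean`);
* `TMP_K` — Zariski–Piltant two-model patching of proper models over `K` (the atom
  `ProperModel.TwoModelPatching` of crux `PatchingRel`, stmt-0642, at the ground field `K`);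
* `Res_K` — every reduced separated `K`-scheme of finite type has a resolution.

Results:
* `atoms_iff_resOver` — **`Temkin_K ∧ RRLU1_K ∧ TMP_K ↔ Res_K` for EVERY field `K` of
  characteristic `p`** (item 0555's split `resolutionInChar_iff_rrLU1_and_twoModelPatching`,
  made fieldwise and absolute: Temkin's theorem enters as a conjunct because `Res_K` returns it);
  `resOver_iff_rrLU1_and_tmp_of_temkinAt` — modulo `Temkin_K` alone, `Res_K ↔ RRLU1_K ∧ TMP_K`.
* `resolutionInChar_iff_atoms`, `palterationThesis_iff_atoms`,
  `resolutionOfSingularities_iff_atoms` — resolution in characteristic `p`, the crux and the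
  summit as "the three atoms over every field", with NO descent statement.
* `palterationThesis_iff_atomsPerfect_and_descent`,
  `resolutionOfSingularities_iff_atomsPerfect_and_descent` — the skeleton's display: the three
  atoms over every PERFECT field of every prime characteristic, and `DescentPerfectToAll`
  (stmt-0549).

Nothing here proves more than the summit: every atom is a consequence of resolution over its own
ground field (`stub_atoms_of_perfectRes`).

Sources: M. Temkin, J. Algebra 373 (2013), Thm. 1.3.2; O. Zariski, Ann. of Math. 41 (1940) and
45 (1944); O. Piltant, RACSAM 107 (2013), Prop. 5.1 and Cor. 5.7; N. Jacobson, *Lectures in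
Abstract Algebra III*, Ch. IV §8.
-/

set_option linter.dupNamespace false -- mandated namespace of this single-conjunct summit

noncomputable section

open CategoryTheory AlgebraicGeometry TopologicalSpace IsLocalRing
open Literature.AlgebraicGeometry.Resolution
open Summit.ResolutionOfSingularities.ResolutionOfSingularities.Theses.PAlteration
open Summit.ResolutionOfSingularities.ResolutionOfSingularities.Theses.Descent (DescentPerfectToAll)
open Summit.ResolutionOfSingularities.ResolutionOfSingularities.Theorems.PalterationThesis.PerfectTransfer
open Summit.ResolutionOfSingularities.ResolutionOfSingularities.Theorems.PalterationThesis.PerfectQuotient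

namespace Summit.ResolutionOfSingularities.ResolutionOfSingularities.Theorems.PalterationThesis.PerfectAtoms

/-! ## The three atoms over one field are exactly resolution over that field -/

/-- **Over a field `K` of characteristic `p`: (Temkin over `K` ∧ RRLU1 over `K` ∧ two-model
patching over `K`) ⟺ resolution of every reduced separated `K`-scheme of finite type**
(`stub_perfectRes_of_atoms`: the Zariski–Piltant engine fed with local uniformization on `K`
obtained by descending RRLU1 along Temkin's purely inseparable extension;
`stub_atoms_of_perfectRes`: a resolution uniformizes every valuation ring and patches every pair
of proper models). [cite: Piltant2013, Prop. 5.1 and Cor. 5.7] -/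
theorem atoms_iff_resOver (p : ℕ) (hp : p.Prime) (K : Type) [Field K] [CharP K p] :
    ((∀ (F : Type) [Field F] [Algebra K F], (⊤ : IntermediateField K F).FG →
        ∀ O : ValuationSubring F, (∀ c : K, algebraMap K F c ∈ O) →
          ∃ (L : Type) (_ : Field L) (_ : Algebra F L) (_ : Algebra K L)
            (_ : IsScalarTower K F L),
            FiniteDimensional F L ∧ IsPurelyInseparable F L ∧
            ∃ O' : ValuationSubring L, O'.comap (algebraMap F L) = O ∧
              IsLocallyUniformizable K L O') ∧
      (∀ (F L : Type) [Field F] [Field L] [Algebra K F] [Algebra F L] [Algebra K L]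
        [IsScalarTower K F L], (⊤ : IntermediateField K F).FG → IsPurelyInseparable F L →
        (∃ y : L, y ^ p ∈ (algebraMap F L).range ∧ IntermediateField.adjoin F {y} = ⊤) →
        ∀ B : Subalgebra K L, B.FG → IsFractionRing B L → IsRegularRing B →
        ∀ O : ValuationSubring L, B.toSubring ≤ O.toSubring →
          IsLocallyUniformizable K F (O.comap (algebraMap F L))) ∧
      (∀ (F : Type) [Field F] [Algebra K F] [Algebra.EssFiniteType K F],
        ∀ M₁ M₂ : ProperModel K F,
          ∃ (N : ProperModel K F) (φ₁ : N.Hom M₁) (φ₂ : N.Hom M₂), φ₁.RegLe ∧ φ₂.RegLe)) ↔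
    ∀ (X : Scheme.{0}) (f : X ⟶ Spec (.of K)),
      IsSeparated f → LocallyOfFiniteType f → QuasiCompact f → IsReduced X →
      Scheme.HasResolution X :=
  ⟨fun h => stub_perfectRes_of_atoms p hp K h.1 h.2.1 h.2.2, stub_atoms_of_perfectRes p hp K⟩

/-- **Modulo Temkin's theorem over `K` alone, resolution over `K` ⟺ RRLU1 over `K` ∧ two-model
patching over `K`** — item 0555's `resolutionInChar_iff_rrLU1_and_twoModelPatching` for ONE
ground field of characteristic `p`. [cite: Temkin2013, Thm. 1.3.2 and Rem. 1.3.5 (ii)–(iii)] -/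
theorem resOver_iff_rrLU1_and_tmp_of_temkinAt (p : ℕ) (hp : p.Prime) (K : Type) [Field K]
    [CharP K p]
    (hT : ∀ (F : Type) [Field F] [Algebra K F], (⊤ : IntermediateField K F).FG →
      ∀ O : ValuationSubring F, (∀ c : K, algebraMap K F c ∈ O) →
        ∃ (L : Type) (_ : Field L) (_ : Algebra F L) (_ : Algebra K L) (_ : IsScalarTower K F L),
          FiniteDimensional F L ∧ IsPurelyInseparable F L ∧
          ∃ O' : ValuationSubring L, O'.comap (algebraMap F L) = O ∧
            IsLocallyUniformizable K L O') :
    (∀ (X : Scheme.{0}) (f : X ⟶ Spec (.of K)),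
      IsSeparated f → LocallyOfFiniteType f → QuasiCompact f → IsReduced X →
      Scheme.HasResolution X) ↔
    (∀ (F L : Type) [Field F] [Field L] [Algebra K F] [Algebra F L] [Algebra K L]
        [IsScalarTower K F L], (⊤ : IntermediateField K F).FG → IsPurelyInseparable F L →
        (∃ y : L, y ^ p ∈ (algebraMap F L).range ∧ IntermediateField.adjoin F {y} = ⊤) →
        ∀ B : Subalgebra K L, B.FG → IsFractionRing B L → IsRegularRing B →
        ∀ O : ValuationSubring L, B.toSubring ≤ O.toSubring →
          IsLocallyUniformizable K F (O.comap (algebraMap F L))) ∧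
      (∀ (F : Type) [Field F] [Algebra K F] [Algebra.EssFiniteType K F],
        ∀ M₁ M₂ : ProperModel K F,
          ∃ (N : ProperModel K F) (φ₁ : N.Hom M₁) (φ₂ : N.Hom M₂), φ₁.RegLe ∧ φ₂.RegLe) :=
  ⟨fun h => (stub_atoms_of_perfectRes p hp K h).2,
    fun h => stub_perfectRes_of_atoms p hp K hT h.1 h.2⟩

/-! ## Resolution in characteristic `p`, the crux and the summit as the atoms over every field -/

/-- **Resolution in characteristic `p` ⟺ the three atoms over every field of characteristic
`p`** (no descent statement: Temkin's theorem and the RRLU1 descent work over every ground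
field). [cite: Piltant2013, Prop. 5.1 and Cor. 5.7] -/
theorem resolutionInChar_iff_atoms (p : ℕ) (hp : p.Prime) :
    ResolutionInChar.{0} p ↔
      ∀ (K : Type) [Field K] [CharP K p],
        (∀ (F : Type) [Field F] [Algebra K F], (⊤ : IntermediateField K F).FG →
          ∀ O : ValuationSubring F, (∀ c : K, algebraMap K F c ∈ O) →
            ∃ (L : Type) (_ : Field L) (_ : Algebra F L) (_ : Algebra K L)
              (_ : IsScalarTower K F L),
              FiniteDimensional F L ∧ IsPurelyInseparable F L ∧
              ∃ O' : ValuationSubring L, O'.comap (algebraMap F L) = O ∧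
                IsLocallyUniformizable K L O') ∧
        (∀ (F L : Type) [Field F] [Field L] [Algebra K F] [Algebra F L] [Algebra K L]
          [IsScalarTower K F L], (⊤ : IntermediateField K F).FG → IsPurelyInseparable F L →
          (∃ y : L, y ^ p ∈ (algebraMap F L).range ∧ IntermediateField.adjoin F {y} = ⊤) →
          ∀ B : Subalgebra K L, B.FG → IsFractionRing B L → IsRegularRing B →
          ∀ O : ValuationSubring L, B.toSubring ≤ O.toSubring →
            IsLocallyUniformizable K F (O.comap (algebraMap F L))) ∧
        (∀ (F : Type) [Field F] [Algebra K F] [Algebra.EssFiniteType K F],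
          ∀ M₁ M₂ : ProperModel K F,
            ∃ (N : ProperModel K F) (φ₁ : N.Hom M₁) (φ₂ : N.Hom M₂), φ₁.RegLe ∧ φ₂.RegLe) :=
  ⟨fun h K _ _ => (atoms_iff_resOver p hp K).mpr fun X f hs hl hq hr => h K X f hs hl hq hr,
    fun h K _ _ X f hs hl hq hr => (atoms_iff_resOver p hp K).mp (h K) X f hs hl hq hr⟩

/-- **The crux `PalterationThesis` ⟺ the three atoms over every field of every prime
characteristic** (prime by prime the crux is `ResolutionInChar p`,
`palterationThesisAt_iff_resolutionInChar`). [folklore] -/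
theorem palterationThesis_iff_atoms :
    PalterationThesis ↔
      ∀ p : ℕ, p.Prime → ∀ (K : Type) [Field K] [CharP K p],
        (∀ (F : Type) [Field F] [Algebra K F], (⊤ : IntermediateField K F).FG →
          ∀ O : ValuationSubring F, (∀ c : K, algebraMap K F c ∈ O) →
            ∃ (L : Type) (_ : Field L) (_ : Algebra F L) (_ : Algebra K L)
              (_ : IsScalarTower K F L),
              FiniteDimensional F L ∧ IsPurelyInseparable F L ∧
              ∃ O' : ValuationSubring L, O'.comap (algebraMap F L) = O ∧
                IsLocallyUniformizable K L O') ∧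
        (∀ (F L : Type) [Field F] [Field L] [Algebra K F] [Algebra F L] [Algebra K L]
          [IsScalarTower K F L], (⊤ : IntermediateField K F).FG → IsPurelyInseparable F L →
          (∃ y : L, y ^ p ∈ (algebraMap F L).range ∧ IntermediateField.adjoin F {y} = ⊤) →
          ∀ B : Subalgebra K L, B.FG → IsFractionRing B L → IsRegularRing B →
          ∀ O : ValuationSubring L, B.toSubring ≤ O.toSubring →
            IsLocallyUniformizable K F (O.comap (algebraMap F L))) ∧
        (∀ (F : Type) [Field F] [Algebra K F] [Algebra.EssFiniteType K F],
          ∀ M₁ M₂ : ProperModel K F,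
            ∃ (N : ProperModel K F) (φ₁ : N.Hom M₁) (φ₂ : N.Hom M₂), φ₁.RegLe ∧ φ₂.RegLe) := by
  rw [palterationThesis_iff_resolutionOfSingularities]
  exact forall_congr' fun p => forall_congr' fun hp => resolutionInChar_iff_atoms p hp

/-- **Resolution of singularities in positive characteristic ⟺ the three atoms over every field
of every prime characteristic.** [folklore] -/
theorem resolutionOfSingularities_iff_atoms :
    _root_.ResolutionOfSingularities ↔
      ∀ p : ℕ, p.Prime → ∀ (K : Type) [Field K] [CharP K p],
        (∀ (F : Type) [Field F] [Algebra K F], (⊤ : IntermediateField K F).FG →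
          ∀ O : ValuationSubring F, (∀ c : K, algebraMap K F c ∈ O) →
            ∃ (L : Type) (_ : Field L) (_ : Algebra F L) (_ : Algebra K L)
              (_ : IsScalarTower K F L),
              FiniteDimensional F L ∧ IsPurelyInseparable F L ∧
              ∃ O' : ValuationSubring L, O'.comap (algebraMap F L) = O ∧
                IsLocallyUniformizable K L O') ∧
        (∀ (F L : Type) [Field F] [Field L] [Algebra K F] [Algebra F L] [Algebra K L]
          [IsScalarTower K F L], (⊤ : IntermediateField K F).FG → IsPurelyInseparable F L →
          (∃ y : L, y ^ p ∈ (algebraMap F L).range ∧ IntermediateField.adjoin F {y} = ⊤) →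
          ∀ B : Subalgebra K L, B.FG → IsFractionRing B L → IsRegularRing B →
          ∀ O : ValuationSubring L, B.toSubring ≤ O.toSubring →
            IsLocallyUniformizable K F (O.comap (algebraMap F L))) ∧
        (∀ (F : Type) [Field F] [Algebra K F] [Algebra.EssFiniteType K F],
          ∀ M₁ M₂ : ProperModel K F,
            ∃ (N : ProperModel K F) (φ₁ : N.Hom M₁) (φ₂ : N.Hom M₂), φ₁.RegLe ∧ φ₂.RegLe) :=
  palterationThesis_iff_resolutionOfSingularities.symm.trans palterationThesis_iff_atoms

/-! ## The skeleton's display: atoms over perfect fields, and descent -/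

/-- **The crux `PalterationThesis` ⟺ the three atoms over every PERFECT field of every prime
characteristic, and `DescentPerfectToAll`** — the composition `PalterationThesis_of` of line
`Sketch` rev. c3 with its open residues displayed (perfect-field transfer
`palterationThesis_iff_perfect_and_descent`, fieldwise sandwich
`pialtOver_and_picoverOver_iff_perfectField`, and `atoms_iff_resOver`). [folklore] -/
theorem palterationThesis_iff_atomsPerfect_and_descent :
    PalterationThesis ↔
      (∀ p : ℕ, p.Prime → ∀ (K : Type) [Field K] [CharP K p] [PerfectField K],
        (∀ (F : Type) [Field F] [Algebra K F], (⊤ : IntermediateField K F).FG →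
          ∀ O : ValuationSubring F, (∀ c : K, algebraMap K F c ∈ O) →
            ∃ (L : Type) (_ : Field L) (_ : Algebra F L) (_ : Algebra K L)
              (_ : IsScalarTower K F L),
              FiniteDimensional F L ∧ IsPurelyInseparable F L ∧
              ∃ O' : ValuationSubring L, O'.comap (algebraMap F L) = O ∧
                IsLocallyUniformizable K L O') ∧
        (∀ (F L : Type) [Field F] [Field L] [Algebra K F] [Algebra F L] [Algebra K L]
          [IsScalarTower K F L], (⊤ : IntermediateField K F).FG → IsPurelyInseparable F L →
          (∃ y : L, y ^ p ∈ (algebraMap F L).range ∧ IntermediateField.adjoin F {y} = ⊤) →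
          ∀ B : Subalgebra K L, B.FG → IsFractionRing B L → IsRegularRing B →
          ∀ O : ValuationSubring L, B.toSubring ≤ O.toSubring →
            IsLocallyUniformizable K F (O.comap (algebraMap F L))) ∧
        (∀ (F : Type) [Field F] [Algebra K F] [Algebra.EssFiniteType K F],
          ∀ M₁ M₂ : ProperModel K F,
            ∃ (N : ProperModel K F) (φ₁ : N.Hom M₁) (φ₂ : N.Hom M₂), φ₁.RegLe ∧ φ₂.RegLe)) ∧
      DescentPerfectToAll := by
  rw [palterationThesis_iff_perfect_and_descent]
  refine and_congr_left fun _ => ?_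
  refine forall_congr' fun p => forall_congr' fun hp => forall_congr' fun K => ?_
  refine forall_congr' fun _ => forall_congr' fun _ => forall_congr' fun _ => ?_
  rw [pialtOver_and_picoverOver_iff_perfectField p hp K]
  exact (atoms_iff_resOver p hp K).symm

/-- **Resolution of singularities in positive characteristic ⟺ the three atoms over every perfect
field of every prime characteristic, and `DescentPerfectToAll`.** [folklore] -/
theorem resolutionOfSingularities_iff_atomsPerfect_and_descent :
    _root_.ResolutionOfSingularities ↔
      (∀ p : ℕ, p.Prime → ∀ (K : Type) [Field K] [CharP K p] [PerfectField K],
        (∀ (F : Type) [Field F] [Algebra K F], (⊤ : IntermediateField K F).FG →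
          ∀ O : ValuationSubring F, (∀ c : K, algebraMap K F c ∈ O) →
            ∃ (L : Type) (_ : Field L) (_ : Algebra F L) (_ : Algebra K L)
              (_ : IsScalarTower K F L),
              FiniteDimensional F L ∧ IsPurelyInseparable F L ∧
              ∃ O' : ValuationSubring L, O'.comap (algebraMap F L) = O ∧
                IsLocallyUniformizable K L O') ∧
        (∀ (F L : Type) [Field F] [Field L] [Algebra K F] [Algebra F L] [Algebra K L]
          [IsScalarTower K F L], (⊤ : IntermediateField K F).FG → IsPurelyInseparable F L →
          (∃ y : L, y ^ p ∈ (algebraMap F L).range ∧ IntermediateField.adjoin F {y} = ⊤) →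
          ∀ B : Subalgebra K L, B.FG → IsFractionRing B L → IsRegularRing B →
          ∀ O : ValuationSubring L, B.toSubring ≤ O.toSubring →
            IsLocallyUniformizable K F (O.comap (algebraMap F L))) ∧
        (∀ (F : Type) [Field F] [Algebra K F] [Algebra.EssFiniteType K F],
          ∀ M₁ M₂ : ProperModel K F,
            ∃ (N : ProperModel K F) (φ₁ : N.Hom M₁) (φ₂ : N.Hom M₂), φ₁.RegLe ∧ φ₂.RegLe)) ∧
      DescentPerfectToAll :=
  palterationThesis_iff_resolutionOfSingularities.symm.trans
    palterationThesis_iff_atomsPerfect_and_descent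

end Summit.ResolutionOfSingularities.ResolutionOfSingularities.Theorems.PalterationThesis.PerfectAtoms

end
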